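import Mathlib

/-!
# Weighted-homogeneous forms in at least two variables have a non-trivial zero

Folklore lemma used in the analysis of weighted (cobordant) blow-ups: if `Q` is a
weighted-homogeneous polynomial of positive weighted degree in `≥ 2` variables, all weights
positive, over an algebraically closed field `K`, then `Q(c) = 0` for some `c ≠ 0`.  In the local
weighted resolution game (route ResolutionOfSingularities/WeightedInvariant, crux
`LocalWeightedDrop`) the exceptional divisor of the cobordant blow-up `B₊` of a centre of
codimension `m ≥ 2` is `kᵐ ∖ {vertex}` modulo the weighted torus action, and the vanishing of ONE
weighted initial form there is exactly this statement (so e.g. a germ `h^p`, `char k = p`, always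
keeps a singular exceptional point under centres of codimension `≥ 2`).

* `eval_weightScaled` — `Q(τ^{w} · c) = τ^d · Q(c)` for `Q` weighted-homogeneous of degree `d`;
* `exists_eval_eq_zero_of_not_isUnit` — weak Nullstellensatz, one equation;
* `exists_ne_zero_and_eval_eq_zero_of_isWeightedHomogeneous` — the lemma.

Proof of the lemma: either the slice `x₀ = 1` has a zero, or the sliced polynomial is a unit,
hence a non-zero constant `κ`; then by weighted scaling `Q(t, z₀)^{w₀} = κ^{w₀} t^d` for all
`t ≠ 0`, so as polynomials in `t`, and `t = 0` gives `Q(0, z₀) = 0` with `z₀ = (1,…,1) ≠ 0`.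
-/

namespace Literature.AlgebraicGeometry.Resolution

open MvPolynomial

variable {K : Type*} [Field K]

/-- Weighted scaling: for `Q` weighted-homogeneous of weighted degree `d`,
`Q(τ^{w₀}c₀, …, τ^{wₙ}cₙ) = τ^d · Q(c)`. [folklore] -/
theorem eval_weightScaled {σ : Type*} [Fintype σ] {w : σ → ℕ} {Q : MvPolynomial σ K} {d : ℕ}
    (hQ : Q.IsWeightedHomogeneous w d) (τ : K) (c : σ → K) :
    MvPolynomial.eval (fun i => τ ^ w i * c i) Q = τ ^ d * MvPolynomial.eval c Q := by
  classical
  rw [MvPolynomial.eval_eq, MvPolynomial.eval_eq, Finset.mul_sum]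
  refine Finset.sum_congr rfl fun α hα => ?_
  have hwt : Finsupp.weight w α = d := hQ (mem_support_iff.mp hα)
  have hsum : ∑ i ∈ α.support, w i * α i = d := by
    rw [← hwt, Finsupp.weight_apply, Finsupp.sum]
    exact Finset.sum_congr rfl fun i _ => by rw [smul_eq_mul, mul_comm]
  simp_rw [mul_pow, Finset.prod_mul_distrib, ← pow_mul, Finset.prod_pow_eq_pow_sum]
  rw [hsum]
  ring

/-- Weak Nullstellensatz for one equation: over an algebraically closed field a polynomial in
finitely many variables that is not a unit has a zero. [folklore] -/
theorem exists_eval_eq_zero_of_not_isUnit [IsAlgClosed K] {σ : Type*} [Finite σ]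
    {q : MvPolynomial σ K} (hq : ¬ IsUnit q) : ∃ z : σ → K, MvPolynomial.eval z q = 0 := by
  have hne : Ideal.span {q} ≠ ⊤ := by
    rwa [Ne, Ideal.span_singleton_eq_top]
  obtain ⟨𝔫, h𝔫, hle⟩ := Ideal.exists_le_maximal _ hne
  obtain ⟨z, rfl⟩ := (MvPolynomial.isMaximal_iff_eq_vanishingIdeal_singleton (K := K)).1 h𝔫
  refine ⟨z, ?_⟩
  have h := hle (Ideal.subset_span (Set.mem_singleton q))
  rwa [MvPolynomial.mem_vanishingIdeal_singleton_iff] at h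

/-- A weighted-homogeneous polynomial of positive weighted degree in at least two variables, all
weights positive, over an algebraically closed field has a NON-TRIVIAL zero. [folklore] -/
theorem exists_ne_zero_and_eval_eq_zero_of_isWeightedHomogeneous [IsAlgClosed K] {m : ℕ}
    {w : Fin (m + 2) → ℕ} (hw : ∀ i, 0 < w i) {Q : MvPolynomial (Fin (m + 2)) K} {d : ℕ}
    (hQ : Q.IsWeightedHomogeneous w d) (hd : 0 < d) :
    ∃ c : Fin (m + 2) → K, c ≠ 0 ∧ MvPolynomial.eval c Q = 0 := by
  classical
  by_cases hz : ∃ z : Fin (m + 1) → K, MvPolynomial.eval (Fin.cons 1 z : Fin (m + 2) → K) Q = 0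
  · obtain ⟨z, hz⟩ := hz
    refine ⟨Fin.cons 1 z, fun h => ?_, hz⟩
    have := congrFun h 0
    simp at this
  push Not at hz
  -- the slice `x₀ = 1` as a polynomial in the remaining variables
  set g : Fin (m + 2) → MvPolynomial (Fin (m + 1)) K := Fin.cons 1 fun j => X j with hg
  have hq_eval : ∀ z : Fin (m + 1) → K,
      MvPolynomial.eval z (bind₁ g Q) = MvPolynomial.eval (Fin.cons 1 z : Fin (m + 2) → K) Q := by
    intro z
    change eval₂Hom (RingHom.id K) z (bind₁ g Q) = _
    rw [eval₂Hom_bind₁]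
    change MvPolynomial.eval (fun i => MvPolynomial.eval z (g i)) Q = _
    congr 2
    funext i
    refine Fin.cases ?_ (fun j => ?_) i <;> simp [hg]
  have hunit : IsUnit (bind₁ g Q) := by
    by_contra hnu
    obtain ⟨z, hz0⟩ := exists_eval_eq_zero_of_not_isUnit hnu
    exact hz z (by rw [← hq_eval]; exact hz0)
  obtain ⟨κ, -, hqC⟩ := (MvPolynomial.isUnit_iff_eq_C_of_isReduced).mp hunit
  have hconst : ∀ z : Fin (m + 1) → K,
      MvPolynomial.eval (Fin.cons 1 z : Fin (m + 2) → K) Q = κ := fun z => by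
    rw [← hq_eval, hqC, eval_C]
  -- the point `(0, 1, …, 1)`
  set z₀ : Fin (m + 1) → K := fun _ => 1 with hz₀
  refine ⟨Fin.cons 0 z₀, fun h => ?_, ?_⟩
  · have := congrFun h (Fin.succ 0)
    simp [hz₀] at this
  -- `t ↦ Q(t, z₀)` as a univariate polynomial
  set P : Polynomial K := Polynomial.map (MvPolynomial.eval z₀) (finSuccEquiv K (m + 1) Q) with hP
  have hPeval : ∀ y : K, MvPolynomial.eval (Fin.cons y z₀ : Fin (m + 2) → K) Q = P.eval y :=
    fun y => by rw [hP, eval_eq_eval_mv_eval']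
  -- for `t ≠ 0`: `Q(t, z₀)^{w 0} = κ^{w 0} * t^d`
  have hpow : ∀ t : K, t ≠ 0 → (P.eval t) ^ w 0 = κ ^ w 0 * t ^ d := by
    intro t ht
    obtain ⟨τ, hτ⟩ := IsAlgClosed.exists_pow_nat_eq t (hw 0)
    have hτ0 : τ ≠ 0 := by rintro rfl; exact ht (by rw [← hτ, zero_pow (hw 0).ne'])
    set z : Fin (m + 1) → K := fun j => (τ ^ w j.succ)⁻¹ * z₀ j with hzdef
    have hscale : (fun i : Fin (m + 2) => τ ^ w i * (Fin.cons 1 z : Fin (m + 2) → K) i) =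
        (Fin.cons t z₀ : Fin (m + 2) → K) := by
      funext i
      refine Fin.cases ?_ (fun j => ?_) i
      · simp [hτ]
      · simp only [Fin.cons_succ, hzdef]
        rw [← mul_assoc, mul_inv_cancel₀ (pow_ne_zero _ hτ0), one_mul]
    have h1 := eval_weightScaled hQ τ (Fin.cons 1 z : Fin (m + 2) → K)
    rw [hscale, hconst, hPeval] at h1
    rw [h1, mul_pow, ← pow_mul, mul_comm d (w 0), pow_mul, hτ, mul_comm]
  -- hence the polynomial identity, and `t = 0`
  have hR : P ^ w 0 - Polynomial.C (κ ^ w 0) * Polynomial.X ^ d = 0 := by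
    apply Polynomial.eq_zero_of_infinite_isRoot
    apply Set.Infinite.mono (s := {t : K | t ≠ 0})
    · intro t ht
      simp only [Set.mem_setOf_eq] at ht ⊢
      simp [Polynomial.IsRoot, hpow t ht]
    · have : ({t : K | t ≠ 0}) = ({0} : Set K)ᶜ := by ext t; simp
      rw [this]
      haveI : Infinite K := IsAlgClosed.instInfinite
      exact (Set.finite_singleton (0 : K)).infinite_compl
  have h0 : (P.eval 0) ^ w 0 = 0 := by
    have := congrArg (Polynomial.eval 0) hR
    simp only [Polynomial.eval_sub, Polynomial.eval_pow, Polynomial.eval_mul, Polynomial.eval_C,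
      Polynomial.eval_X, Polynomial.eval_zero, zero_pow hd.ne', mul_zero, sub_zero] at this
    exact this
  rw [hPeval]
  exact pow_eq_zero_iff (hw 0).ne' |>.mp h0

end Literature.AlgebraicGeometry.Resolution
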